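import Summits.BirchSwinnertonDyer.BirchSwinnertonDyer.Theorems.ResidualThetaTransportAtTwoSignedMuSeedAtTwoPlusJetRobertLevelOne
import Mathlib.AlgebraicGeometry.EllipticCurve.Affine.Point
import HarnessLib

/-!
# Doubling on `Ẽ : y² + y = x³` in characteristic `2` (`[2]P = −Frob₄ P` on points), `p₁(C) ∈ 𝔽₄`, and
# `NonDeg(1)` at `N𝔩 = 5` for the `𝔣₀ = 1` Robert function — a first UNIFORM instance of J5/S4
# (seed lines `norm-field-tilt` S4 / `jet-character-sums` J5; crux `SignedMuSeedAtTwoPlus` stmt-BirchSwinnertonDyer-21438; Kμ⁺ stmt-BirchSwinnertonDyer-20689)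

Cell `bsd-wall`, width seat `bsd-wall-rtt-p4-w2` g14 (`--supports`, closes nothing).  THEOREMS ONLY; the lines are NOT registered (W-79);
BSD is not proved by this.

`…JetRobertLevelOne` reduced `NonDeg(1)` for the `𝔣₀ = 1` Robert function `θ̄ = ∏_{P ∈ (C∖O)/±} 1/(x + x(P))` (diagonal `ρ`, `ū ∈ 𝔽₄∖𝔽₂`)
to `p₁(C) := Σ_{P∈(C∖O)/±} x(P) ≠ 0`.  This file computes the group-theoretic input on the curve side, with Mathlib's affine
addition law (`WeierstrassCurve.Affine.slope/addX/addY/Point`):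

* §1 **`[2](x, y) = (x⁴, y⁴ + 1) = −Frob₄(x, y)`** on `Ẽ` (char `2`, any model with `a₁ = a₂ = a₄ = a₆ = 0`, `a₃ = 1`): `negY_eq` (`−(x,y) = (x, y+1)`),
  `slope_self_eq` (tangent slope `x²`), `addX_self_eq` (`x([2]P) = x⁴`), `addY_self_eq` (`y([2]P) = y⁴ + 1`), `nonsingular_of_equation`,
  `nonsingular_frob`, **`add_self_eq_neg_frob`** (`P + P = −Frob₄ P` in `Ẽ.Point`) — the point-level shadow of `[−2] = Frob₄`
  (`Tilt.formalMul_two_of_charP` is the formal-group version).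
* §2 **`add_self_eq_neg_of_pow_four_eq`**: `x(P)⁴ = x(P) ⟹ P + P = −P` (then `y⁴ = y` by the equation): points with `x ∈ 𝔽₄` are `3`-torsion;
  hence **`x_pow_four_ne_of_five_smul_eq_zero`**: a point of order `5` has `x(P)⁴ ≠ x(P)`, i.e. **`p₁(⟨P⟩) = x(P) + x(2P) = x + x⁴ ≠ 0`**
  (`(C∖O)/± = {P, 2P}` for `#C = 5`).
* §3 `p₁ ∈ 𝔽₄`: **`sum_pow_four_eq_sum`** — a finite set of `x`-values stable under `x ↦ x⁴` (as `(C∖O)/±` is under `[−2] = Frob₄`) has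
  `(Σ x)⁴ = Σ x`; over a field `p₁ ≠ 0 ⟹ p₁³ = 1` (`pow_three_eq_one_of_pow_four_eq`).
* §4 **`nonDeg_one_order_five`**: for `P = (x, y) ∈ Ẽ` of order `5` over a field `k ⊇ 𝔽₄` of characteristic `2`, Robert factors
  `θ₀(t + x w) = w`, `θ₁(t + x⁴ w) = w`, `S₀ = λΦ(λt) + λ²Φ(λ²t)` (`Φ = θ₀ + θ₁`, `λ² + λ + 1 = 0`), `δ ≡ ūt⁴ (mod t⁸)`, `ū² + ū + 1 = 0`:
  `ord S₀ = 4 ∧ ord S₁ = 12` — **`NonDeg(1)` holds for EVERY subgroup of order `5`**, uniformly (the `N𝔩 = 5`, `𝔣₀ = 1` instance of J5/S4 in the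
  diagonal model; what remains there is the dictionary S1 (ii)/(iii), not a non-vanishing question).

References: [SilvermanAEC2009] III.2.3 (group law), the cards. [folklore]
-/

set_option autoImplicit false
-- the Theorems namespace of this sub repeats the summit name by design (D-0017 nested layout)
set_option linter.dupNamespace false

noncomputable section

open PowerSeries Finset

namespace Summit.BirchSwinnertonDyer.BirchSwinnertonDyer.Theorems.SignedMuAtTwo.JetCharacterSums

/-! ## §1 Doubling on `y² + y = x³` in characteristic `2` -/

section Doubling

variable {K : Type*} [Field K] [CharP K 2] (E : WeierstrassCurve.Affine K)
  (h₁ : E.a₁ = 0) (h₂ : E.a₂ = 0) (h₃ : E.a₃ = 1) (h₄ : E.a₄ = 0) (h₆ : E.a₆ = 0)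

include h₁ h₃ in
/-- `−(x, y) = (x, y + 1)` on `y² + y = x³` in characteristic `2`. [cite: SilvermanAEC2009, III.2.3] -/
theorem negY_eq (x y : K) : E.negY x y = y + 1 := by
  rw [WeierstrassCurve.Affine.negY, h₁, h₃]
  linear_combination (-(y + 1)) * (CharTwo.two_eq_zero (R := K))

include h₁ h₃ in
/-- `y ≠ −(y) − a₁x − a₃`: no point of `y² + y = x³` is `2`-torsion (characteristic `2`: `2y + 1 = 1 ≠ 0`). [cite: SilvermanAEC2009, III.2.3] -/
theorem Y_ne_negY (x y : K) : y ≠ E.negY x y := by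
  rw [negY_eq E h₁ h₃]
  intro h
  exact (one_ne_zero : (1 : K) ≠ 0) (by linear_combination -h)

omit [CharP K 2] in
include h₁ h₂ h₃ h₄ h₆ in
/-- The curve equation: `E.Equation x y ↔ y² + y = x³`. [cite: SilvermanAEC2009, III.1] -/
theorem equation_iff_tilt (x y : K) : E.Equation x y ↔ y ^ 2 + y = x ^ 3 := by
  rw [WeierstrassCurve.Affine.equation_iff, h₁, h₂, h₃, h₄, h₆]
  constructor <;> intro h <;> linear_combination h

include h₁ h₃ in
/-- Every point of `y² + y = x³` on the curve is nonsingular (`∂/∂y = 2y + 1 = 1`). [cite: SilvermanAEC2009, III.1] -/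
theorem nonsingular_of_equation {x y : K} (h : E.Equation x y) : E.Nonsingular x y :=
  (WeierstrassCurve.Affine.nonsingular_iff _ _).mpr ⟨h, Or.inr (Y_ne_negY E h₁ h₃ x y)⟩

variable [DecidableEq K]

include h₁ h₂ h₃ h₄ in
/-- **Tangent slope `x²`** at `(x, y)` (`(3x² + 2a₂x + a₄ − a₁y)/(y − (−y − a₁x − a₃)) = 3x²/1`, and `3 = 1`). [cite: SilvermanAEC2009, III.2.3] -/
theorem slope_self_eq (x y : K) : E.slope x x y y = x ^ 2 := by
  rw [WeierstrassCurve.Affine.slope_of_Y_ne rfl (Y_ne_negY E h₁ h₃ x y), WeierstrassCurve.Affine.negY, h₁, h₂, h₃, h₄]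
  have h2 : (2 : K) = 0 := CharTwo.two_eq_zero
  have hden : y - (-y - 0 * x - 1) = 1 := by linear_combination y * h2
  rw [hden, div_one]
  linear_combination x ^ 2 * h2

omit [DecidableEq K] in
include h₁ h₂ in
/-- **`x([2]P) = x⁴`** (`addX x x x² = x⁴ + a₁x² − a₂ − 2x`). [cite: SilvermanAEC2009, III.2.3] -/
theorem addX_self_eq (x : K) : E.addX x x (x ^ 2) = x ^ 4 := by
  rw [WeierstrassCurve.Affine.addX, h₁, h₂]
  linear_combination (-x) * (CharTwo.two_eq_zero (R := K))

omit [DecidableEq K] in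
include h₁ h₂ h₃ h₄ h₆ in
/-- **`y([2]P) = y⁴ + 1`** for `(x, y)` on the curve (`x⁶ + x³ = (y² + y)² + (y² + y)`). [cite: SilvermanAEC2009, III.2.3] -/
theorem addY_self_eq {x y : K} (h : E.Equation x y) : E.addY x x y (x ^ 2) = y ^ 4 + 1 := by
  rw [equation_iff_tilt E h₁ h₂ h₃ h₄ h₆] at h
  rw [WeierstrassCurve.Affine.addY, WeierstrassCurve.Affine.negAddY, addX_self_eq E h₁ h₂, WeierstrassCurve.Affine.negY, h₁, h₃]
  have h2 : (2 : K) = 0 := CharTwo.two_eq_zero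
  linear_combination (x ^ 3 + y ^ 2 + y - 1) * h + (-1 - y ^ 4 - y ^ 3) * h2

omit [DecidableEq K] in
include h₁ h₂ h₃ h₄ h₆ in
/-- The Frobenius `(x, y) ↦ (x⁴, y⁴)` preserves the curve (it is defined over `𝔽₂`). [cite: SilvermanAEC2009, III.1] -/
theorem nonsingular_frob {x y : K} (h : E.Nonsingular x y) : E.Nonsingular (x ^ 4) (y ^ 4) := by
  refine nonsingular_of_equation E h₁ h₃ ?_
  have he := (equation_iff_tilt E h₁ h₂ h₃ h₄ h₆ x y).mp h.1
  rw [equation_iff_tilt E h₁ h₂ h₃ h₄ h₆]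
  have h2 : (2 : K) = 0 := CharTwo.two_eq_zero
  have hf : (y ^ 2 + y) ^ 4 = (x ^ 3) ^ 4 := by rw [he]
  linear_combination hf + (-(2 * y ^ 7) - 3 * y ^ 6 - 2 * y ^ 5) * h2

include h₁ h₂ h₃ h₄ h₆ in
/-- **`[2]P = −Frob₄(P)`** on points: `(x, y) + (x, y) = −(x⁴, y⁴) = (x⁴, y⁴ + 1)` in `Ẽ.Point` — the point-level shadow of `[−2] = Frob₄`
(`Tilt.formalMul_two_of_charP` on the formal group). [cite: SilvermanAEC2009, III.2.3] -/
theorem add_self_eq_neg_frob {x y : K} (h : E.Nonsingular x y) :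
    WeierstrassCurve.Affine.Point.some x y h + WeierstrassCurve.Affine.Point.some x y h =
      -WeierstrassCurve.Affine.Point.some (x ^ 4) (y ^ 4) (nonsingular_frob E h₁ h₂ h₃ h₄ h₆ h) := by
  rw [WeierstrassCurve.Affine.Point.add_self_of_Y_ne (Y_ne_negY E h₁ h₃ x y), WeierstrassCurve.Affine.Point.neg_some,
    WeierstrassCurve.Affine.Point.some.injEq]
  refine ⟨by rw [slope_self_eq E h₁ h₂ h₃ h₄, addX_self_eq E h₁ h₂], ?_⟩
  rw [slope_self_eq E h₁ h₂ h₃ h₄, addY_self_eq E h₁ h₂ h₃ h₄ h₆ h.1, negY_eq E h₁ h₃]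

/-! ## §2 `x ∈ 𝔽₄ ⟹ 3P = O`; a point of order `5` has `x + x⁴ ≠ 0` -/

include h₁ h₂ h₃ h₄ h₆ in
/-- **`x(P)⁴ = x(P) ⟹ P + P = −P`** (so `3P = O`): from the equation also `y⁴ = y`, and `[2]P = (x⁴, y⁴+1) = (x, y+1) = −P`. [cite: SilvermanAEC2009, III.2.3] -/
theorem add_self_eq_neg_of_pow_four_eq {x y : K} (h : E.Nonsingular x y) (hx : x ^ 4 = x) :
    WeierstrassCurve.Affine.Point.some x y h + WeierstrassCurve.Affine.Point.some x y h = -WeierstrassCurve.Affine.Point.some x y h := by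
  have he := (equation_iff_tilt E h₁ h₂ h₃ h₄ h₆ x y).mp h.1
  have h2 : (2 : K) = 0 := CharTwo.two_eq_zero
  -- `y⁴ + y² = x⁶ = x³ = y² + y`, so `(y⁴ − y) = 0`; as `y⁴ − y = (y² − y)... ` we argue: `(y⁴ + y) = (x⁶ + x³) + 2(...)`
  have hy4 : y ^ 4 = y := by
    have hx6 : x ^ 6 = x ^ 3 := by linear_combination x ^ 2 * hx
    linear_combination (y ^ 2 + y + x ^ 3 - 1) * he + hx6 - y ^ 3 * h2
  rw [add_self_eq_neg_frob E h₁ h₂ h₃ h₄ h₆ h, WeierstrassCurve.Affine.Point.neg_some, WeierstrassCurve.Affine.Point.neg_some,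
    WeierstrassCurve.Affine.Point.some.injEq]
  exact ⟨hx, by rw [hx, hy4]⟩

include h₁ h₂ h₃ h₄ h₆ in
/-- **A point of order `5` has `x(P)⁴ ≠ x(P)`**, i.e. `p₁(⟨P⟩) = x(P) + x([2]P) = x + x⁴ ≠ 0` (`(⟨P⟩∖O)/± = {P, 2P}`): otherwise `3P = O`
and `5P = O` force `P = O`. [cite: SilvermanAEC2009, III.2.3] -/
theorem x_pow_four_ne_of_five_smul_eq_zero {x y : K} (h : E.Nonsingular x y)
    (h5 : (5 : ℕ) • WeierstrassCurve.Affine.Point.some x y h = 0) : x ^ 4 ≠ x := by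
  intro hx
  have h2P := add_self_eq_neg_of_pow_four_eq E h₁ h₂ h₃ h₄ h₆ h hx
  set P := WeierstrassCurve.Affine.Point.some x y h with hP
  have h3 : (3 : ℕ) • P = 0 := by
    rw [show (3 : ℕ) = 2 + 1 from rfl, add_nsmul, one_nsmul, two_nsmul, h2P, neg_add_cancel]
  have hP0 : P = 0 := by
    have e : P = (2 : ℕ) • ((3 : ℕ) • P) - (5 : ℕ) • P := by
      rw [← mul_nsmul', show 2 * 3 = 5 + 1 from rfl, add_nsmul, one_nsmul, add_sub_cancel_left]
    rw [e, h3, h5, smul_zero, sub_zero]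
  exact WeierstrassCurve.Affine.Point.some_ne_zero h hP0

include h₁ h₂ h₃ h₄ h₆ in
/-- The same as the non-vanishing of the pole-coordinate sum: `x + x⁴ ≠ 0`. [folklore] -/
theorem x_add_x_pow_four_ne_zero_of_five_smul_eq_zero {x y : K} (h : E.Nonsingular x y)
    (h5 : (5 : ℕ) • WeierstrassCurve.Affine.Point.some x y h = 0) : x + x ^ 4 ≠ 0 := by
  intro hs
  exact x_pow_four_ne_of_five_smul_eq_zero E h₁ h₂ h₃ h₄ h₆ h h5 (by linear_combination hs - x * (CharTwo.two_eq_zero (R := K)))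

end Doubling

/-! ## §3 `p₁ ∈ 𝔽₄`: Frobenius-stable pole sets -/

section Frobenius

variable {R : Type*} [CommRing R] [CharP R 2]

/-- **`(Σ_{x∈s} x)⁴ = Σ_{x∈s} x` for a finite set stable under `x ↦ x⁴`** (reduced ring of characteristic `2`; `(C∖O)/±` is stable under
`[−2] = Frob₄`, so `p₁(C)⁴ = p₁(C)`: `p₁ ∈ 𝔽₄`). [folklore] -/
theorem sum_pow_four_eq_sum [IsReduced R] [DecidableEq R] (s : Finset R) (hs : s.image (fun x => x ^ 4) = s) : (∑ x ∈ s, x) ^ 4 = ∑ x ∈ s, x := by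
  have hinj : Set.InjOn (fun x : R => x ^ 4) s := by
    intro a _ b _ hab
    have h := frobenius_inj R 2
    have hab' : (a ^ 2) ^ 2 = (b ^ 2) ^ 2 := by simpa [← pow_mul] using hab
    exact h (h hab')
  calc (∑ x ∈ s, x) ^ 4 = ∑ x ∈ s, x ^ 4 := by
        rw [show (4 : ℕ) = 2 * 2 from rfl, pow_mul, sum_pow_char 2 s, sum_pow_char 2 s]
        exact Finset.sum_congr rfl fun i _ => by ring
    _ = ∑ x ∈ s.image (fun x => x ^ 4), x := (Finset.sum_image (f := fun x => x) hinj).symm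
    _ = ∑ x ∈ s, x := by rw [hs]

omit [CharP R 2] in
/-- Over a domain: `p⁴ = p`, `p ≠ 0 ⟹ p³ = 1` — a non-zero Frobenius-stable pole sum is a cube root of unity (so is `[t¹²]S₁ = p₁²`). [folklore] -/
theorem pow_three_eq_one_of_pow_four_eq [IsDomain R] {p : R} (h4 : p ^ 4 = p) (hp : p ≠ 0) : p ^ 3 = 1 := by
  have h : p * (p ^ 3 - 1) = 0 := by linear_combination h4
  rcases mul_eq_zero.mp h with h0 | h1
  · exact absurd h0 hp
  · linear_combination h1

end Frobenius

/-! ## §4 `NonDeg(1)` at `N𝔩 = 5`, uniformly -/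

section OrderFive

variable {K : Type*} [Field K] [CharP K 2] [DecidableEq K] (E : WeierstrassCurve.Affine K)
  (h₁ : E.a₁ = 0) (h₂ : E.a₂ = 0) (h₃ : E.a₃ = 1) (h₄ : E.a₄ = 0) (h₆ : E.a₆ = 0)

include h₁ h₂ h₃ h₄ h₆ in
/-- **`NonDeg(1)` for every subgroup of order `5`** (`𝔣₀ = 1`, diagonal `ρ`): for `P = (x, y) ∈ Ẽ(K)` with `5P = O`, the Robert function
`θ̄ = 1/(x + x(P)) · 1/(x + x(2P))` (`x(2P) = x⁴`; factors `θ₀(t + x w) = w`, `θ₁(t + x⁴ w) = w`), `S₀ = λΦ(λt) + λ²Φ(λ²t)` with `Φ = θ₀ + θ₁`,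
`λ² + λ + 1 = 0`, and any `δ ≡ ūt⁴ (mod t⁸)` with `ū² + ū + 1 = 0`: **`ord S₀ = 4` and `ord (S₀ + S₀(t + δ)) = 12`** (`12 + 2 < 4²`).
[folklore] -/
theorem nonDeg_one_order_five {x y : K} (h : E.Nonsingular x y) (h5 : (5 : ℕ) • WeierstrassCurve.Affine.Point.some x y h = 0)
    {θ₀ θ₁ : K⟦X⟧} (hθ₀ : θ₀ * (X + C x * (⟨0, 0, 1, 0, 0⟩ : WeierstrassCurve K).formalW) = (⟨0, 0, 1, 0, 0⟩ : WeierstrassCurve K).formalW)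
    (hθ₁ : θ₁ * (X + C (x ^ 4) * (⟨0, 0, 1, 0, 0⟩ : WeierstrassCurve K).formalW) = (⟨0, 0, 1, 0, 0⟩ : WeierstrassCurve K).formalW)
    {l : K} (hl : l ^ 2 + l + 1 = 0) {δ : K⟦X⟧} {u : K} (hδ : (X : K⟦X⟧) ^ 8 ∣ δ - C u * X ^ 4) (hu : u ^ 2 + u + 1 = 0) :
    PowerSeries.order (C l * rescale l (θ₀ + θ₁) + C (l ^ 2) * rescale (l ^ 2) (θ₀ + θ₁)) = ((4 : ℕ) : ℕ∞) ∧
      PowerSeries.order ((C l * rescale l (θ₀ + θ₁) + C (l ^ 2) * rescale (l ^ 2) (θ₀ + θ₁)) +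
        (C l * rescale l (θ₀ + θ₁) + C (l ^ 2) * rescale (l ^ 2) (θ₀ + θ₁)).subst (X + δ) : K⟦X⟧) = ((12 : ℕ) : ℕ∞) ∧
      (12 + 2 < 4 ^ (1 + 1)) := by
  have hp : x + x ^ 4 ≠ 0 := x_add_x_pow_four_ne_zero_of_five_smul_eq_zero E h₁ h₂ h₃ h₄ h₆ h h5
  -- index the two poles by `Fin 2`
  have hθ : ∀ i ∈ (Finset.univ : Finset (Fin 2)), ![θ₀, θ₁] i * (X + C (![x, x ^ 4] i) * (⟨0, 0, 1, 0, 0⟩ : WeierstrassCurve K).formalW) =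
      (⟨0, 0, 1, 0, 0⟩ : WeierstrassCurve K).formalW := by
    intro i _
    fin_cases i
    · exact hθ₀
    · exact hθ₁
  have hsum : ∑ i ∈ (Finset.univ : Finset (Fin 2)), ![x, x ^ 4] i ≠ 0 := by
    rw [Fin.sum_univ_two]; exact hp
  have H := nonDeg_one_robertSum hθ hl hδ hu hsum
  simp only [Fin.sum_univ_two, Matrix.cons_val_zero, Matrix.cons_val_one] at H
  exact ⟨H.1, H.2.1, H.2.2.2⟩

end OrderFive

end Summit.BirchSwinnertonDyer.BirchSwinnertonDyer.Theorems.SignedMuAtTwo.JetCharacterSums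

end
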